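import Summits.ABC.IUTFork.LDHSlotResiduePointPair
import Summits.ABC.IUTFork.LDHSplitBadPrimeExplicitL
import Literature.IUT.LogVolume.PilotSlotResidueMixedShare
import Literature.IUT.LogVolume.PilotSlotResidueSupport
import HarnessLib

/-!
# The fork at [IUTchIII] Corollary 3.12, L-DH level, READING (U): the computable half at `d_mod ≥ 2` IS a bound on the
# WHOLE `log(q)`-share of the bad/good-mixed primes — closed form, and its composition with the necessity of the residue

Record-only PROOF file (D-0012) of the abc-iut cell (R2 S-chain seat abc-iut-s2-p2; sequel to abc-iut-S8's
`LDHSlotResidue.lean`, abc-iut-S7's `LDHSlotResiduePointPair.lean` and the Literature-level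
`PilotSlotResidueMixedShare.lean`); TAKES NO SIDE on [IUTchIII] Cor. 3.12 or [IUTchIV] Thm. 1.10. S. Mochizuki, *IUT IV*
[Mochizuki2012], proof of Thm. 1.10 Step (v), kurims pp. 27–28 ("after symmetrizing with respect to the choice of
"`i† ∈ I`" … does not affect the computation of the upper bound"); Cor. 2.2 (ii) proof p. 46 ((P5): `𝕍^bad_mod` = the
places of `F_mod` not dividing `2l` of bad multiplicative reduction); Dupuy–Hilado [DupuyHilado2025] §3.3, §3.6, §4.7
((Ind1) = permutations of the tensor factors), §4.10–4.12; HOME/plan/c312/STEPV-IND1-NOTE.md §4.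

THE POINT. abc-iut-S8 proved that every hull-volume estimate in reading (U) dominates the (Ind1) slot residue
(`DHData.slotResidue_le_of_estimateDH`, `PointDict.slotResidue_le_of_hullVolumeAtDatum`), and bounded the residue below by
ONE PAIR of places (`slotResidue_ge_pair_closed`, the `Pr(v)·Pr(w)`-fraction). `PilotSlotResidueMixedShare` sharpens the
pair bound to the WHOLE share: at a prime `p` over which the non-`S` places of `F` carry weight `ω_p > 0`, the residue is
`≥ μ̄_p·(c_ℓ − (1/ℓ⋆)Σ_{i<ℓ⋆}(i+1)²(1−ω_p)^{i+1})`, `c_ℓ·μ̄_p` = the `p`-part of `deĝ̲_lgp(P_Θ)` (= `((l+1)/24)·log q` at `p`,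
normalised). THIS FILE closes the geometric tail with abc-iut-w5-d018's `Σ(n+1)²β^{n+1} ≤ 2β/(1−β)³` and composes:

* `PilotData.sum_weight_le_one` / `tail_le_closed` — `ω_Z ≤ 1`; `(1/ℓ⋆)Σ_{i<ℓ⋆}(i+1)²(1−ω)^{i+1} ≤ 2(1−ω)/(ℓ⋆·ω³)` for `0 < ω ≤ 1`;
* **`PilotData.slotResidue_ge_mixedShare_closed`** — for primes `W ⊆ T` with `ω_p > 0` on `W`:
  `Σ_{p∈W} μ̄_p·(c_ℓ − 2(1−ω_p)/(ℓ⋆·ω_p³)) ≤ slotResidue X T`; `…_closed_of_support` — the same for ANY finite set of primes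
  `W` against `slotResidue X T`, `T ⊇ char(S)` (canonicity of the residue, abc-iut-S8 `slotResidue_eq_of_support`);
* **`DHData.mixedShare_le_of_estimateDH`** / **`DHData.mixedShare_le_of_hullEstimateOf`** — every Dupuy–Hilado hull estimate
  `EstimateDH δ`, resp. every `HullEstimateOf δ` of a GENUINE Θ-volume input, forces `Σ_{p∈W} μ̄_p·(c_ℓ − 2(1−ω_p)/(ℓ⋆ω_p³)) ≤ δ`;
* **`PointDict.mixedShare_le_of_hullEstimateOf`** / **`PointDict.mixedShare_le_of_hullVolumeAtDatum`** — AT THE `λ`-LINE, in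
  the printed quantities of the datum (abc-iut-S7 `PointDict.mu_eq`: `μ_T(u) = (−ord_u(j_E))/(2l)·ln N(u)/n_u` on `𝕍^bad_mod`,
  `0` off it; `c_ℓ = l(l+1)/12`, `ℓ⋆ = (l−1)/2`): `Cor22.HullVolumeAtDatum P l δ` (the conclusion of the crux's registered
  (U)-stubs `stub_hullVolume` / `stub_hullRegime` of stmt-ABC-19678, there with print's `δ = B_III(P,l)`) forces, for EVERY
  genuine datum `T` at `(P,l)` and every finite set `W` of rational primes each lying under a non-bad place of `F_mod` of
  positive weight `ω_p`:
  `Σ_{p∈W} (Σ_{v|p, v∈𝕍^bad_mod} Pr(v)·(−ord_v(j_E))/(2l)·ln N(v)/n_v)·(l(l+1)/12 − 4(1−ω_p)/((l−1)·ω_p³)) ≤ δ`,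
  i.e. `((l+1)/24)·(1/[F_mod:ℚ])·Σ_{v|p bad}(−ord_v(j_E))·ln N(v)` — the WHOLE normalised local height of the `q`-parameter
  at the bad places over each MIXED prime — times `1 − 48(1−ω_p)/((l−1)l(l+1)ω_p³)`, summed over the mixed primes, is
  `≤ δ`; single-prime form `PointDict.localHeightShare_le_of_hullVolumeAtDatum`.

READING (for the planners; nothing asserted about print). Together with abc-iut-c312-d1's all-regime SUFFICIENCY
(`hullEstimateOf_BIII_of_slotResidue_le_slack`: residue `≤ slack(P,l) ≈ (5/3)(l+1)·d*·l` ⟹ (ii′-U)) and the upper bound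
`slotResidue ≤ Σ_{mixed p} c_ℓ·μ̄_p` (`PilotData.slotResidue_le_mixedShare`), this pins the (U)-line residual of the cell
(`hvol` of `abc_of_S_v3`, `hreg` of `abc_of_S_v4`; VERDICT RISK ¶7) at `d_mod ≥ 2` as the Diophantine statement «the
`log(q^{∤{2,l}})`-share of `λ` at the primes of `F_mod = ℚ(j(λ))` lying under both a bad and a non-bad place is
`≲ (24/(l+1))·B_III(P,l)`», up to the factor `1 − O(ℓ⁻²·ω⁻³)` below and the Step (ii)(iii)(viii) slack above: a height
condition on the point of Szpiro/abc type — neither a log-volume computation ([IUTchIV] Steps (v)–(viii) supply it for no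
`d_mod ≥ 2` datum with a mixed prime) nor kernel-refutable without certifying (P2)/(P6) at log-height `≳ 10⁸·d_mod·l`
(abc-iut-w6-d018 sizing). HONEST SCOPE: consequences of the typed (U)-computable half at genuine data; no datum is
constructed; the per-image reading (P) has no residue; no side taken; typed ≠ proved. PROOF-ONLY file: 0 definitions,
no `Prop` facts. [cite: Mochizuki2012, IUTchIV Thm. 1.10 Step (v) p. 27–28] [cite: Mochizuki2012, IUTchIV Cor. 2.2 (ii) proof p. 46]
[cite: DupuyHilado2025, §3.3, §3.6, §4.7, §4.10–4.12] [claim: Mochizuki2012, status: disputed] for every IUT quotation.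
-/

noncomputable section

/-! ## The geometric tail in closed form (pilot data over any number field) -/

namespace Literature.IUT.LogVolume

namespace PilotData

open NumberField IsDedekindDomain Finset Summit.ABC.IUTFork

variable {F : Type} [Field F] [NumberField F] (X : PilotData F)

/-- The weight of any set of places over a prime is at most `1` (`Σ_{v|p} Pr(v) = 1`, `Pr ≥ 0`).
[cite: DupuyHilado2025, §3.6] -/
theorem sum_weight_le_one (p : ℕ) [Fact p.Prime] (Z : Finset (placesOver F p)) :
    ∑ v ∈ Z, weight F v.1 ≤ 1 := by
  rw [← sum_weight_placesOver (F := F) p]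
  exact Finset.sum_le_sum_of_subset_of_nonneg (Finset.subset_univ Z) fun v _ _ => weight_nonneg F v.1

/-- **The geometric tail in closed form**: for `0 < ω ≤ 1`,
`(1/ℓ⋆)·Σ_{i<ℓ⋆}(i+1)²(1−ω)^{i+1} ≤ 2(1−ω)/(ℓ⋆·ω³)` (abc-iut-w5-d018's `Σ'(n+1)²β^{n+1} ≤ 2β/(1−β)³` at `β = 1−ω`).
[folklore] -/
theorem tail_le_closed {ω : ℝ} (h0 : 0 < ω) (h1 : ω ≤ 1) :
    (1 / (X.lstar : ℝ)) * ∑ i : Fin X.lstar, (((i : ℕ) + 1 : ℝ) ^ 2) * (1 - ω) ^ ((i : ℕ) + 1) ≤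
      2 * (1 - ω) / ((X.lstar : ℝ) * ω ^ 3) := by
  have hβ0 : 0 ≤ 1 - ω := by linarith
  have hβ1 : 1 - ω < 1 := by linarith
  have hl : (0 : ℝ) < X.lstar := by
    have := X.two_le_lstar; exact_mod_cast (by omega : 0 < X.lstar)
  have hsum : ∑ i : Fin X.lstar, (((i : ℕ) + 1 : ℝ) ^ 2) * (1 - ω) ^ ((i : ℕ) + 1) ≤ 2 * (1 - ω) / ω ^ 3 := by
    have h1' := SplitBadPrime.sum_sq_pow_le_tsum hβ0 hβ1 X.lstar
    have h2' := SplitBadPrime.tsum_sq_mul_pow_le hβ0 hβ1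
    have h3 : (1 - (1 - ω)) = ω := by ring
    rw [h3] at h2'
    exact h1'.trans h2'
  calc (1 / (X.lstar : ℝ)) * ∑ i : Fin X.lstar, (((i : ℕ) + 1 : ℝ) ^ 2) * (1 - ω) ^ ((i : ℕ) + 1)
      ≤ (1 / (X.lstar : ℝ)) * (2 * (1 - ω) / ω ^ 3) :=
        mul_le_mul_of_nonneg_left hsum (by positivity)
    _ = 2 * (1 - ω) / ((X.lstar : ℝ) * ω ^ 3) := by
        field_simp

/-- **The mixed-share lower bound in CLOSED form.** For finite sets of primes `W ⊆ T`, zero-sets `Z_p` of places over `p`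
outside `S` with weights `ω_p = Σ_{v∈Z_p} Pr(v) > 0` (`p ∈ W`):
`Σ_{p∈W} μ̄_p·(c_ℓ − 2(1−ω_p)/(ℓ⋆·ω_p³)) ≤ slotResidue X T`, `μ̄_p = Σ_{v|p} P_q(v)·ln N(v)/n_v·Pr(v)`, `c_ℓ = (ℓ⋆+1)(2ℓ⋆+1)/6`.
[cite: DupuyHilado2025, §4.7, §4.11, §4.12] [cite: Mochizuki2012, IUTchIV Thm. 1.10 Step (v) p. 27–28] -/
theorem slotResidue_ge_mixedShare_closed (T W : Finset ℕ) (hW : W ⊆ T) (hT : ∀ p ∈ T, p.Prime)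
    (Z : (p : ℕ) → Finset (placesOver F p)) (hZ : ∀ p ∈ W, ∀ v ∈ Z p, v.1 ∉ X.S)
    (hω : ∀ p ∈ W, 0 < ∑ v ∈ Z p, weight F v.1) :
    ∑ p ∈ W, (∑ v : placesOver F p, X.qPilot v.1 * logNorm F v.1 / (localDegree F v.1 : ℝ) * weight F v.1) *
        ((((X.lstar : ℝ) + 1) * (2 * X.lstar + 1) / 6)
          - 2 * (1 - ∑ v ∈ Z p, weight F v.1) / ((X.lstar : ℝ) * (∑ v ∈ Z p, weight F v.1) ^ 3)) ≤
      X.slotResidue T := by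
  have hWp : ∀ p ∈ W, p.Prime := fun p hp => hT p (hW hp)
  refine le_trans ?_ ((X.slotResidue_ge_mixedShare W hWp Z hZ).trans (X.slotResidue_mono hW))
  refine Finset.sum_le_sum fun p hp => ?_
  haveI : Fact p.Prime := ⟨hWp p hp⟩
  refine mul_le_mul_of_nonneg_left ?_ (X.sum_mu_mul_weight_nonneg p)
  have ht := X.tail_le_closed (hω p hp) (sum_weight_le_one p (Z p))
  linarith

/-- **Closed form against the canonical residue**: for `T ⊇ char(S)` a finite set of primes (e.g. abc-iut-S2's
`supportPrimes`) and ANY finite set of primes `W` with zero-sets `Z_p` outside `S` of positive weight: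
`Σ_{p∈W} μ̄_p·(c_ℓ − 2(1−ω_p)/(ℓ⋆·ω_p³)) ≤ slotResidue X T` (the residue does not depend on the bookkeeping set,
abc-iut-S8 `slotResidue_eq_of_support`; primes of `W` under no bad place contribute `μ̄_p = 0`).
[cite: DupuyHilado2025, Def. 3.6.3, §4.7] -/
theorem slotResidue_ge_mixedShare_closed_of_support (T W : Finset ℕ) (hT : ∀ p ∈ T, p.Prime)
    (hS : ∀ v ∈ X.S, residueChar F v ∈ T) (hW : ∀ p ∈ W, p.Prime)
    (Z : (p : ℕ) → Finset (placesOver F p)) (hZ : ∀ p ∈ W, ∀ v ∈ Z p, v.1 ∉ X.S)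
    (hω : ∀ p ∈ W, 0 < ∑ v ∈ Z p, weight F v.1) :
    ∑ p ∈ W, (∑ v : placesOver F p, X.qPilot v.1 * logNorm F v.1 / (localDegree F v.1 : ℝ) * weight F v.1) *
        ((((X.lstar : ℝ) + 1) * (2 * X.lstar + 1) / 6)
          - 2 * (1 - ∑ v ∈ Z p, weight F v.1) / ((X.lstar : ℝ) * (∑ v ∈ Z p, weight F v.1) ^ 3)) ≤
      X.slotResidue T := by
  classical
  have hTW : ∀ p ∈ T ∪ W, p.Prime := fun p hp => by
    rcases Finset.mem_union.mp hp with h | h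
    · exact hT p h
    · exact hW p h
  have heq : X.slotResidue (T ∪ W) = X.slotResidue T :=
    X.slotResidue_eq_of_support hTW hT (fun v hv => Finset.mem_union_left _ (hS v hv)) hS
  rw [← heq]
  exact X.slotResidue_ge_mixedShare_closed (T ∪ W) W Finset.subset_union_right hTW Z hZ hω

end PilotData

end Literature.IUT.LogVolume

namespace Summit.ABC.IUTFork

open Literature.IUT.LogVolume NumberField IsDedekindDomain

/-! ## Dupuy–Hilado data and genuine Θ-volume inputs -/

namespace DHData

section DH

variable {F : Type} [Field F] [NumberField F] (D : DHData F)

/-- **Every DH hull-volume estimate bounds the mixed `log(q)`-share**: `EstimateDH δ` forces, for every finite set of primes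
`W` and zero-sets `Z_p ⊆ V(F)_p ∖ S` of positive weight `ω_p`, `Σ_{p∈W} μ̄_p·(c_ℓ − 2(1−ω_p)/(ℓ⋆·ω_p³)) ≤ δ`
(abc-iut-S8 `slotResidue_le_of_estimateDH` ∘ `slotResidue_ge_mixedShare_closed_of_support`).
[cite: Mochizuki2012, IUTchIV Thm. 1.10 Step (v) p. 27–28] [cite: DupuyHilado2025, §4.7, §4.12] -/
theorem mixedShare_le_of_estimateDH {δ : ℝ} (h : D.EstimateDH δ) (W : Finset ℕ) (hW : ∀ p ∈ W, p.Prime)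
    (Z : (p : ℕ) → Finset (placesOver F p)) (hZ : ∀ p ∈ W, ∀ v ∈ Z p, v.1 ∉ D.X.S)
    (hω : ∀ p ∈ W, 0 < ∑ v ∈ Z p, weight F v.1) :
    ∑ p ∈ W, (∑ v : placesOver F p, D.X.qPilot v.1 * logNorm F v.1 / (localDegree F v.1 : ℝ) * weight F v.1) *
        ((((D.X.lstar : ℝ) + 1) * (2 * D.X.lstar + 1) / 6)
          - 2 * (1 - ∑ v ∈ Z p, weight F v.1) / ((D.X.lstar : ℝ) * (∑ v ∈ Z p, weight F v.1) ^ 3)) ≤ δ :=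
  (D.X.slotResidue_ge_mixedShare_closed_of_support D.T W D.T_prime D.S_sub hW Z hZ hω).trans
    (D.slotResidue_le_of_estimateDH h)

end DH

section Input

variable {F₀ : Type} [Field F₀] [NumberField F₀] {K : Type} [Field K] [NumberField K] [Algebra F₀ K]
variable (I : ThetaVolumeInput F₀ K)

/-- **For every genuine Θ-volume input**: `HullEstimateOf I δ` forces the mixed-share inequality
`Σ_{p∈W} μ̄_p·(c_ℓ − 2(1−ω_p)/(ℓ⋆·ω_p³)) ≤ δ` for every finite set of primes `W` and zero-sets of positive weight
outside `S` (abc-iut-S8 `slotResidue_le_of_hullEstimateOf`; the residue is canonical on `supportPrimes ⊇ char(S)`).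
[cite: Mochizuki2012, IUTchIV Thm. 1.10 Step (v) p. 27–28] [cite: DupuyHilado2025, §4.7, §4.12] -/
theorem mixedShare_le_of_hullEstimateOf {δ : ℝ} (h : I.HullEstimateOf δ) (W : Finset ℕ) (hW : ∀ p ∈ W, p.Prime)
    (Z : (p : ℕ) → Finset (placesOver F₀ p)) (hZ : ∀ p ∈ W, ∀ v ∈ Z p, v.1 ∉ I.X.S)
    (hω : ∀ p ∈ W, 0 < ∑ v ∈ Z p, weight F₀ v.1) :
    ∑ p ∈ W, (∑ v : placesOver F₀ p, I.X.qPilot v.1 * logNorm F₀ v.1 / (localDegree F₀ v.1 : ℝ) * weight F₀ v.1) *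
        ((((I.X.lstar : ℝ) + 1) * (2 * I.X.lstar + 1) / 6)
          - 2 * (1 - ∑ v ∈ Z p, weight F₀ v.1) / ((I.X.lstar : ℝ) * (∑ v ∈ Z p, weight F₀ v.1) ^ 3)) ≤ δ :=
  (I.X.slotResidue_ge_mixedShare_closed_of_support I.supportPrimes W (fun _ hp => I.prime_of_mem_supportPrimes hp)
      (fun _ hv => I.residueChar_mem_supportPrimes hv) hW Z hZ hω).trans
    (slotResidue_le_of_hullEstimateOf I h)

end Input

end DHData

/-! ## At the `λ`-line: what child (ii′)/(U) asserts at `d_mod ≥ 2`, in the datum's printed quantities -/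

namespace PointDict

open Literature.IUT.HodgeTheaters Literature.NumberTheory.DiophantineGeometry.GenEll
open scoped Classical

variable {P : NFPoint} {l : ℕ}

/-- At a datum of `(P, l)`: `ℓ⋆ = (l−1)/2` as a real number. [cite: Mochizuki2012, IUTchI Def. 3.1 (c) p. 61] -/
theorem lstar_cast_eq (T : Cor22.ThetaVolumeDatumAt P l) :
    (letI := T.instFieldF; letI := T.instNumberFieldF; letI := T.instAlgebraF; letI := T.instFieldK
     letI := T.instNumberFieldK; letI := T.instAlgebraK; letI := T.instFieldFbar; letI := T.instAlgebraFbar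
     letI := T.instAlgebraKFbar; letI := T.instIsElliptic
     (T.I.X.lstar : ℝ)) = ((l : ℝ) - 1) / 2 := by
  letI := T.instFieldF; letI := T.instNumberFieldF; letI := T.instAlgebraF; letI := T.instFieldK
  letI := T.instNumberFieldK; letI := T.instAlgebraK; letI := T.instFieldFbar; letI := T.instAlgebraFbar
  letI := T.instAlgebraKFbar; letI := T.instIsElliptic
  have h1 : (T.I.X.l : ℝ) = 2 * T.I.X.lstar + 1 := T.I.X.l_cast
  have h2 : T.I.X.l = l := (X_S_eq T).2.2
  rw [h2] at h1
  linarith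

/-- The `μ̄_p` of a datum in printed quantities: `Σ_{v|p} μ_T(v)·Pr(v) = Σ_{v|p} 𝟙[v∈𝕍^bad_mod]·(−ord_v(j_E))/(2l)·ln N(v)/n_v·Pr(v)`
(abc-iut-S7 `mu_eq`). [cite: DupuyHilado2025, §3.3, §3.6] -/
theorem sum_mu_weight_eq (T : Cor22.ThetaVolumeDatumAt P l) :
    (letI := T.instFieldF; letI := T.instNumberFieldF; letI := T.instAlgebraF; letI := T.instFieldK
     letI := T.instNumberFieldK; letI := T.instAlgebraK; letI := T.instFieldFbar; letI := T.instAlgebraFbar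
     letI := T.instAlgebraKFbar; letI := T.instIsElliptic
     ∀ p : ℕ, ∑ v : placesOver (fieldOfModuli T.E) p,
         T.I.X.qPilot v.1 * logNorm (fieldOfModuli T.E) v.1 / (localDegree (fieldOfModuli T.E) v.1 : ℝ) *
           weight (fieldOfModuli T.E) v.1 =
       ∑ v : placesOver (fieldOfModuli T.E) p,
         (if v.1 ∈ ThetaData.badPrimesMod T.D then
             ((-ord (fieldOfModuli T.E) v.1 (ThetaData.jMod T.E) : ℤ) : ℝ) / (2 * (l : ℝ)) *
               logNorm (fieldOfModuli T.E) v.1 / (localDegree (fieldOfModuli T.E) v.1 : ℝ)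
           else 0) * weight (fieldOfModuli T.E) v.1) := by
  letI := T.instFieldF; letI := T.instNumberFieldF; letI := T.instAlgebraF; letI := T.instFieldK
  letI := T.instNumberFieldK; letI := T.instAlgebraK; letI := T.instFieldFbar; letI := T.instAlgebraFbar
  letI := T.instAlgebraKFbar; letI := T.instIsElliptic
  intro p
  exact Finset.sum_congr rfl fun v _ => by rw [mu_eq T v.1]

/-- **The (U)-computable half at a datum bounds the WHOLE `log(q)`-share at the mixed primes.** If `T.HullEstimateOf δ`,
then for every finite set `W` of rational primes such that over each `p ∈ W` the places of `F_mod = ℚ(j_E)` OUTSIDE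
`𝕍^bad_mod` carry positive weight `ω_p = Σ_{v|p, v∉𝕍^bad_mod} Pr(v)`:
`Σ_{p∈W} (Σ_{v|p, v∈𝕍^bad_mod} Pr(v)·(−ord_v(j_E))/(2l)·ln N(v)/n_v)·(l(l+1)/12 − 4(1−ω_p)/((l−1)·ω_p³)) ≤ δ`.
[cite: Mochizuki2012, IUTchIV Thm. 1.10 Step (v) p. 27–28] [cite: DupuyHilado2025, §3.3, §3.6, §4.7, §4.12]
[claim: Mochizuki2012, status: disputed] -/
theorem mixedShare_le_of_hullEstimateOf (T : Cor22.ThetaVolumeDatumAt P l) {δ : ℝ} (h : T.HullEstimateOf δ) :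
    (letI := T.instFieldF; letI := T.instNumberFieldF; letI := T.instAlgebraF; letI := T.instFieldK
     letI := T.instNumberFieldK; letI := T.instAlgebraK; letI := T.instFieldFbar; letI := T.instAlgebraFbar
     letI := T.instAlgebraKFbar; letI := T.instIsElliptic
     ∀ W : Finset ℕ, (∀ p ∈ W, p.Prime) →
       (∀ p ∈ W, 0 < ∑ v ∈ Finset.univ.filter
          (fun v : placesOver (fieldOfModuli T.E) p => v.1 ∉ ThetaData.badPrimesMod T.D),
            weight (fieldOfModuli T.E) v.1) →
       ∑ p ∈ W, (∑ v : placesOver (fieldOfModuli T.E) p,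
           (if v.1 ∈ ThetaData.badPrimesMod T.D then
               ((-ord (fieldOfModuli T.E) v.1 (ThetaData.jMod T.E) : ℤ) : ℝ) / (2 * (l : ℝ)) *
                 logNorm (fieldOfModuli T.E) v.1 / (localDegree (fieldOfModuli T.E) v.1 : ℝ)
             else 0) * weight (fieldOfModuli T.E) v.1) *
         ((l : ℝ) * ((l : ℝ) + 1) / 12
           - 4 * (1 - ∑ v ∈ Finset.univ.filter
                (fun v : placesOver (fieldOfModuli T.E) p => v.1 ∉ ThetaData.badPrimesMod T.D),
                  weight (fieldOfModuli T.E) v.1) /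
             (((l : ℝ) - 1) * (∑ v ∈ Finset.univ.filter
                (fun v : placesOver (fieldOfModuli T.E) p => v.1 ∉ ThetaData.badPrimesMod T.D),
                  weight (fieldOfModuli T.E) v.1) ^ 3)) ≤ δ) := by
  letI := T.instFieldF; letI := T.instNumberFieldF; letI := T.instAlgebraF; letI := T.instFieldK
  letI := T.instNumberFieldK; letI := T.instAlgebraK; letI := T.instFieldFbar; letI := T.instAlgebraFbar
  letI := T.instAlgebraKFbar; letI := T.instIsElliptic
  intro W hW hω
  have hZ : ∀ p ∈ W, ∀ v ∈ Finset.univ.filter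
      (fun v : placesOver (fieldOfModuli T.E) p => v.1 ∉ ThetaData.badPrimesMod T.D), v.1 ∉ T.I.X.S := by
    intro p _ v hv
    rw [(X_S_eq T).1]
    exact (Finset.mem_filter.mp hv).2
  have hmain := DHData.mixedShare_le_of_hullEstimateOf T.I h W hW
    (fun p => Finset.univ.filter
      (fun v : placesOver (fieldOfModuli T.E) p => v.1 ∉ ThetaData.badPrimesMod T.D)) hZ hω
  have hl1 : (T.I.X.lstar : ℝ) = ((l : ℝ) - 1) / 2 := lstar_cast_eq T
  have hc : ((T.I.X.lstar : ℝ) + 1) * (2 * T.I.X.lstar + 1) / 6 = (l : ℝ) * ((l : ℝ) + 1) / 12 := avgSq_eq T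
  refine le_trans (le_of_eq (Finset.sum_congr rfl fun p hp => ?_)) hmain
  rw [sum_mu_weight_eq T p, hc, hl1]
  congr 1
  have hωp := hω p hp
  have hl2 : ((l : ℝ) - 1) ≠ 0 := by
    have : (0 : ℝ) < T.I.X.lstar := by
      have := T.I.X.two_le_lstar; exact_mod_cast (by omega : 0 < T.I.X.lstar)
    rw [hl1] at this
    intro h0; rw [h0] at this; simp at this
  field_simp
  ring

/-- **Child (ii′) on the (U) line AT THE `λ`-LINE, mixed prime by mixed prime.** `Cor22.HullVolumeAtDatum P l δ` (the
conclusion of the registered (U)-stubs of stmt-ABC-19678 with print's `δ = B_III(P,l)`; the CONE binder `hvol` of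
`abc_of_S_v3`, and — at non-slot-constant data, which every datum with a mixed prime is — `hreg` of `abc_of_S_v4`) asserts,
for EVERY genuine Θ-volume datum `T` at `(P,l)` and every finite set `W` of rational primes under non-bad places of `F_mod`
of positive weight: `Σ_{p∈W} μ̄_p(T)·(l(l+1)/12 − 4(1−ω_p)/((l−1)ω_p³)) ≤ δ` — with
`(l(l+1)/12)·μ̄_p(T) = ((l+1)/24)·(1/[F_mod:ℚ])·Σ_{v|p, v∈𝕍^bad_mod} (−ord_v(j_E))·ln N(v)` the WHOLE normalised local height of
the `q`-parameter of `E_λ` over the mixed prime `p`. Empty content at `d_mod = 1` (no prime has both kinds of places); at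
`d_mod ≥ 2` a Szpiro/abc-type height condition on the point. Nothing asserted about any point; no side taken.
[cite: Mochizuki2012, IUTchIV Thm. 1.10 Step (v) p. 27–28] [cite: Mochizuki2012, IUTchIV Cor. 2.2 (ii) proof p. 46]
[claim: Mochizuki2012, status: disputed] -/
theorem mixedShare_le_of_hullVolumeAtDatum {δ : ℝ} (h : Cor22.HullVolumeAtDatum P l δ)
    (T : Cor22.ThetaVolumeDatumAt P l) :
    (letI := T.instFieldF; letI := T.instNumberFieldF; letI := T.instAlgebraF; letI := T.instFieldK
     letI := T.instNumberFieldK; letI := T.instAlgebraK; letI := T.instFieldFbar; letI := T.instAlgebraFbar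
     letI := T.instAlgebraKFbar; letI := T.instIsElliptic
     ∀ W : Finset ℕ, (∀ p ∈ W, p.Prime) →
       (∀ p ∈ W, 0 < ∑ v ∈ Finset.univ.filter
          (fun v : placesOver (fieldOfModuli T.E) p => v.1 ∉ ThetaData.badPrimesMod T.D),
            weight (fieldOfModuli T.E) v.1) →
       ∑ p ∈ W, (∑ v : placesOver (fieldOfModuli T.E) p,
           (if v.1 ∈ ThetaData.badPrimesMod T.D then
               ((-ord (fieldOfModuli T.E) v.1 (ThetaData.jMod T.E) : ℤ) : ℝ) / (2 * (l : ℝ)) *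
                 logNorm (fieldOfModuli T.E) v.1 / (localDegree (fieldOfModuli T.E) v.1 : ℝ)
             else 0) * weight (fieldOfModuli T.E) v.1) *
         ((l : ℝ) * ((l : ℝ) + 1) / 12
           - 4 * (1 - ∑ v ∈ Finset.univ.filter
                (fun v : placesOver (fieldOfModuli T.E) p => v.1 ∉ ThetaData.badPrimesMod T.D),
                  weight (fieldOfModuli T.E) v.1) /
             (((l : ℝ) - 1) * (∑ v ∈ Finset.univ.filter
                (fun v : placesOver (fieldOfModuli T.E) p => v.1 ∉ ThetaData.badPrimesMod T.D),
                  weight (fieldOfModuli T.E) v.1) ^ 3)) ≤ δ) :=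
  mixedShare_le_of_hullEstimateOf T (h T)

/-- **Single mixed prime**: `Cor22.HullVolumeAtDatum P l δ` forces, at every datum and every rational prime `p` under a
non-bad place of `F_mod` of positive weight `ω_p`, `μ̄_p(T)·(l(l+1)/12 − 4(1−ω_p)/((l−1)ω_p³)) ≤ δ` — e.g. at a prime
split in `F_mod` into a bad and a good place of equal local degree (`ω_p = 1/2`): `(l(l+1)/12 − 32/(l−1))·μ̄_p(T) ≤ δ`,
the whole local height at `p` once `l ≥ 13`. [cite: Mochizuki2012, IUTchIV Thm. 1.10 Step (v) p. 27–28]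
[claim: Mochizuki2012, status: disputed] -/
theorem localHeightShare_le_of_hullVolumeAtDatum {δ : ℝ} (h : Cor22.HullVolumeAtDatum P l δ)
    (T : Cor22.ThetaVolumeDatumAt P l) :
    (letI := T.instFieldF; letI := T.instNumberFieldF; letI := T.instAlgebraF; letI := T.instFieldK
     letI := T.instNumberFieldK; letI := T.instAlgebraK; letI := T.instFieldFbar; letI := T.instAlgebraFbar
     letI := T.instAlgebraKFbar; letI := T.instIsElliptic
     ∀ (p : ℕ), p.Prime →
       0 < ∑ v ∈ Finset.univ.filter
          (fun v : placesOver (fieldOfModuli T.E) p => v.1 ∉ ThetaData.badPrimesMod T.D),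
            weight (fieldOfModuli T.E) v.1 →
       (∑ v : placesOver (fieldOfModuli T.E) p,
           (if v.1 ∈ ThetaData.badPrimesMod T.D then
               ((-ord (fieldOfModuli T.E) v.1 (ThetaData.jMod T.E) : ℤ) : ℝ) / (2 * (l : ℝ)) *
                 logNorm (fieldOfModuli T.E) v.1 / (localDegree (fieldOfModuli T.E) v.1 : ℝ)
             else 0) * weight (fieldOfModuli T.E) v.1) *
         ((l : ℝ) * ((l : ℝ) + 1) / 12
           - 4 * (1 - ∑ v ∈ Finset.univ.filter
                (fun v : placesOver (fieldOfModuli T.E) p => v.1 ∉ ThetaData.badPrimesMod T.D),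
                  weight (fieldOfModuli T.E) v.1) /
             (((l : ℝ) - 1) * (∑ v ∈ Finset.univ.filter
                (fun v : placesOver (fieldOfModuli T.E) p => v.1 ∉ ThetaData.badPrimesMod T.D),
                  weight (fieldOfModuli T.E) v.1) ^ 3)) ≤ δ) := by
  letI := T.instFieldF; letI := T.instNumberFieldF; letI := T.instAlgebraF; letI := T.instFieldK
  letI := T.instNumberFieldK; letI := T.instAlgebraK; letI := T.instFieldFbar; letI := T.instAlgebraFbar
  letI := T.instAlgebraKFbar; letI := T.instIsElliptic
  intro p hp hω
  have h1 := mixedShare_le_of_hullVolumeAtDatum h T {p} (fun q hq => by rwa [Finset.mem_singleton.mp hq])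
    (fun q hq => by rw [Finset.mem_singleton.mp hq]; exact hω)
  rwa [Finset.sum_singleton] at h1

end PointDict

end Summit.ABC.IUTFork

end
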